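import Literature.Probability.RandomPlanarGeometry.ConformalRemovabilityShadows
import HarnessLib

/-!
# Conformal removability: `Σ_v τ(v)² ≤ 6 Σ_v (q v + 1)² rad v²` (Jones–Smirnov Thm. 2, p. 275)

Support for the proof of `JonesSmirnov2000_frontier_of_isHolderDomain` (Jones–Smirnov 2000,
Cor. 2; `ConformalRemovability.lean`); second half of `ConformalRemovabilityShadows.lean`.
We formalise the displayed computation on p. 275 of P. W. Jones, S. K. Smirnov, Ark. Mat. 38
(2000) (planar case `n = 2`): along the greedy chain `v = v₀, v₁, …` (`q(v_j) = q(v) + j`),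
Hölder's inequality with the weights `(q(v_j)+1)^{3/2}` gives
`τ(v)² ≤ (Σ_j rad(v_j)² (q(v_j)+1)^{3/2}) (Σ_j (q(v)+j+1)^{-3/2}) ≤ 3 (q(v)+1)^{-1/2} Σ_j …`,
and exchanging the order of summation — a vertex `u` lies on the greedy chain of at most one
vertex of each level `≤ q(u)` (its ancestors), and `Σ_{l ≤ q(u)} (l+1)^{-1/2} ≤ 2 (q(u)+1)^{1/2}` —
yields `Σ_v τ(v)² ≤ 6 Σ_u rad(u)² (q(u)+1)²`.

* (the telescoping inequalities `Σ_{j<n} ((m+1+j)√(m+1+j))⁻¹ ≤ 3/√(m+1)` and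
  `Σ_{l ≤ n} (√(l+1))⁻¹ ≤ 2 √(n+1)` are in `ConformalRemovabilityShadows.lean`);
* `iterate_parent_iterate_greedy` — `parent^[j] (g^[j] v) = v` along the greedy chain;
* `sum_range_weight_le` — the weights `rad(v_j)² (q(v_j)+1)^{3/2}` along a greedy chain have
  partial sums `≤ M = Σ_u (q u+1)² rad u²`;
* `sq_le_of_isLUB` — the Hölder step for one vertex;
* `sum_sq_le_of_isLUB` — the exchange of summation: `Σ_{v ∈ S} τ(v)² ≤ 6 M` for finite `S`;
* `exists_tailSup` — MAIN RESULT, self-contained: for the abstract rooted graph with finite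
  fibres and `M = Σ_v (q v+1)² rad v² < ∞` there is `τ : V → ℝ`, `0 ≤ rad ≤ τ`, dominating the
  tail sums of radii along every ray, with `Σ_v τ(v)² ≤ 6 M`.

## References

* [JonesSmirnov2000] P. W. Jones, S. K. Smirnov, *Removability theorems for Sobolev functions and
  quasiconformal maps*, Ark. Mat. 38 (2000) 263–279, §3, proof of Thm. 2 (pp. 274–275).
-/

noncomputable section

open Set Filter Finset Metric
open scoped Topology BigOperators

namespace Literature.Probability.RandomPlanarGeometry

/-! ### The greedy chain: ancestors and weights -/

section Greedy

variable {V : Type*} {root : V} {parent : V → V} {q : V → ℕ} {rad : V → ℝ} {τ : V → ℝ}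
  {g : V → V}

/-- Along the greedy chain `parent^[j] (g^[j] v) = v` while children exist. [folklore] -/
theorem iterate_parent_iterate_greedy
    (hg : ∀ v, (∃ w, parent w = v ∧ w ≠ root) →
      parent (g v) = v ∧ g v ≠ root ∧ ∀ w, parent w = v → w ≠ root → τ w ≤ τ (g v)) {v : V} :
    ∀ {j : ℕ}, (∀ i < j, ∃ w, parent w = g^[i] v ∧ w ≠ root) → parent^[j] (g^[j] v) = v
  | 0, _ => rfl
  | j + 1, hact => by
    rw [Function.iterate_succ_apply' g j v, Function.iterate_succ_apply parent j,
      (hg _ (hact j (Nat.lt_succ_self j))).1]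
    exact iterate_parent_iterate_greedy hg fun i hi => hact i (by omega)

/-- Levels along the greedy chain: `q (g^[j] v) = q v + j` while children exist. [folklore] -/
theorem q_iterate_greedy (hq : ∀ v, v ≠ root → q v = q (parent v) + 1)
    (hg : ∀ v, (∃ w, parent w = v ∧ w ≠ root) →
      parent (g v) = v ∧ g v ≠ root ∧ ∀ w, parent w = v → w ≠ root → τ w ≤ τ (g v)) {v : V}
    {j : ℕ} (hact : ∀ i < j, ∃ w, parent w = g^[i] v ∧ w ≠ root) : q (g^[j] v) = q v + j := by
  have hch := iterate_greedy_chain hg hact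
  have := q_apply_chain hq (c := fun i => g^[i] v) hch.1 hch.2 j le_rfl
  simpa using this

/-- **The weights along a greedy chain are dominated by `M`**: the partial sums of
`𝟙_A(j) rad(g^[j] v)² (q(g^[j] v)+1)^{3/2}` are at most `Σ_u (q u+1)² rad u²` (the active
`g^[j] v` are distinct vertices, and `t^{3/2} ≤ t²` for `t ≥ 1`). [folklore] -/
theorem sum_range_weight_le (hq : ∀ v, v ≠ root → q v = q (parent v) + 1)
    (hsum : Summable fun v => ((q v : ℝ) + 1) ^ 2 * rad v ^ 2)
    (hg : ∀ v, (∃ w, parent w = v ∧ w ≠ root) →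
      parent (g v) = v ∧ g v ≠ root ∧ ∀ w, parent w = v → w ≠ root → τ w ≤ τ (g v))
    (v : V) (n : ℕ) :
    ∑ j ∈ range n, {j : ℕ | ∀ i < j, ∃ w, parent w = g^[i] v ∧ w ≠ root}.indicator
      (fun j => rad (g^[j] v) ^ 2 * (((q (g^[j] v) : ℝ) + 1) * Real.sqrt ((q (g^[j] v) : ℝ) + 1))) j
      ≤ ∑' u, ((q u : ℝ) + 1) ^ 2 * rad u ^ 2 := by
  classical
  set A : Set ℕ := {j : ℕ | ∀ i < j, ∃ w, parent w = g^[i] v ∧ w ≠ root} with hA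
  set s : Finset ℕ := (range n).filter fun j => j ∈ A with hs
  have hinj : Set.InjOn (fun j => g^[j] v) ↑s := by
    intro j hj j' hj' h
    simp only [hs, coe_filter, mem_setOf_eq] at hj hj'
    have h1 := q_iterate_greedy hq hg hj.2
    have h2 := q_iterate_greedy hq hg hj'.2
    have := congrArg q h
    simp only at this
    omega
  calc ∑ j ∈ range n, A.indicator (fun j => rad (g^[j] v) ^ 2 *
          (((q (g^[j] v) : ℝ) + 1) * Real.sqrt ((q (g^[j] v) : ℝ) + 1))) j
      = ∑ j ∈ s, rad (g^[j] v) ^ 2 *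
          (((q (g^[j] v) : ℝ) + 1) * Real.sqrt ((q (g^[j] v) : ℝ) + 1)) := by
        rw [hs, sum_filter]
        refine sum_congr rfl fun j _ => ?_
        by_cases hj : j ∈ A
        · rw [indicator_of_mem hj, if_pos hj]
        · rw [indicator_of_notMem hj, if_neg hj]
    _ ≤ ∑ j ∈ s, (fun u => ((q u : ℝ) + 1) ^ 2 * rad u ^ 2) (g^[j] v) := by
        refine sum_le_sum fun j _ => ?_
        have h1 : (1 : ℝ) ≤ (q (g^[j] v) : ℝ) + 1 := by linarith [(q (g^[j] v)).cast_nonneg (α := ℝ)]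
        have hsqrt : Real.sqrt ((q (g^[j] v) : ℝ) + 1) ≤ (q (g^[j] v) : ℝ) + 1 := by
          rw [Real.sqrt_le_left (by linarith)]
          nlinarith
        have : ((q (g^[j] v) : ℝ) + 1) * Real.sqrt ((q (g^[j] v) : ℝ) + 1) ≤
            ((q (g^[j] v) : ℝ) + 1) ^ 2 := by nlinarith
        calc _ ≤ rad (g^[j] v) ^ 2 * ((q (g^[j] v) : ℝ) + 1) ^ 2 := by gcongr
          _ = _ := by ring
    _ = ∑ u ∈ s.image fun j => g^[j] v, ((q u : ℝ) + 1) ^ 2 * rad u ^ 2 := by rw [sum_image hinj]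
    _ ≤ ∑' u, ((q u : ℝ) + 1) ^ 2 * rad u ^ 2 := hsum.sum_le_tsum _ fun u _ => by positivity

/-- The weights along a greedy chain are summable. [folklore] -/
theorem summable_weight (hq : ∀ v, v ≠ root → q v = q (parent v) + 1)
    (hsum : Summable fun v => ((q v : ℝ) + 1) ^ 2 * rad v ^ 2)
    (hg : ∀ v, (∃ w, parent w = v ∧ w ≠ root) →
      parent (g v) = v ∧ g v ≠ root ∧ ∀ w, parent w = v → w ≠ root → τ w ≤ τ (g v)) (v : V) :
    Summable ({j : ℕ | ∀ i < j, ∃ w, parent w = g^[i] v ∧ w ≠ root}.indicator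
      fun j => rad (g^[j] v) ^ 2 * (((q (g^[j] v) : ℝ) + 1) * Real.sqrt ((q (g^[j] v) : ℝ) + 1))) :=
  summable_of_sum_range_le (fun j => indicator_nonneg (fun _ _ => by positivity) _)
    (sum_range_weight_le hq hsum hg v)

/-! ### The Hölder step -/

/-- **Hölder along the greedy chain** (Jones–Smirnov 2000, p. 275, `n = 2`):
`τ(v)² ≤ 3 (q(v)+1)^{-1/2} Σ_j 𝟙_A(j) rad(g^[j] v)² (q(g^[j] v)+1)^{3/2}` — Cauchy–Schwarz with the
weights `(q(v)+j+1)^{3/2}` on the representation `τ v = Σ_j 𝟙_A(j) rad (g^[j] v)`, and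
`Σ_j (q(v)+j+1)^{-3/2} ≤ 3 (q(v)+1)^{-1/2}`. [cite: JonesSmirnov2000, §3 proof of Thm. 2 (p. 275)] -/
theorem sq_le_of_isLUB (hq : ∀ v, v ≠ root → q v = q (parent v) + 1)
    (hrad : ∀ v, 0 ≤ rad v) (hsum : Summable fun v => ((q v : ℝ) + 1) ^ 2 * rad v ^ 2)
    (hτ : ∀ v, IsLUB {s : ℝ | ∃ (m : ℕ) (c : ℕ → V), c 0 = v ∧ (∀ i < m, parent (c (i + 1)) = c i) ∧
      (∀ i < m, c (i + 1) ≠ root) ∧ s = ∑ i ∈ range (m + 1), rad (c i)} (τ v))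
    (hg : ∀ v, (∃ w, parent w = v ∧ w ≠ root) →
      parent (g v) = v ∧ g v ≠ root ∧ ∀ w, parent w = v → w ≠ root → τ w ≤ τ (g v)) (v : V) :
    τ v ^ 2 ≤ 3 / Real.sqrt ((q v : ℝ) + 1) *
      ∑' j, {j : ℕ | ∀ i < j, ∃ w, parent w = g^[i] v ∧ w ≠ root}.indicator
        (fun j => rad (g^[j] v) ^ 2 *
          (((q (g^[j] v) : ℝ) + 1) * Real.sqrt ((q (g^[j] v) : ℝ) + 1))) j := by
  classical
  set A : Set ℕ := {j : ℕ | ∀ i < j, ∃ w, parent w = g^[i] v ∧ w ≠ root} with hA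
  set wt : ℕ → ℝ := A.indicator fun j => rad (g^[j] v) with hwt
  set G : ℕ → ℝ := A.indicator fun j => rad (g^[j] v) ^ 2 *
    (((q (g^[j] v) : ℝ) + 1) * Real.sqrt ((q (g^[j] v) : ℝ) + 1)) with hGdef
  set p : ℕ → ℝ := fun j => ((q v : ℝ) + j + 1) * Real.sqrt ((q v : ℝ) + j + 1) with hp
  have hp0 : ∀ j, 0 < p j := fun j => by simp only [hp]; positivity
  have hGsum : Summable G := summable_weight hq hsum hg v
  have hG0 : ∀ j, 0 ≤ G j := fun j => indicator_nonneg (fun _ _ => by positivity) _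
  -- partial sums of `wt` tend to `τ v`
  have hS : Tendsto (fun n => ∑ j ∈ range n, wt j) atTop (𝓝 (τ v)) :=
    (hasSum_indicator_of_isLUB hq hrad hsum hτ hg v).tendsto_sum_nat
  -- Cauchy–Schwarz on each partial sum
  have hCS : ∀ n, (∑ j ∈ range n, wt j) ^ 2 ≤ 3 / Real.sqrt ((q v : ℝ) + 1) * ∑' j, G j := by
    intro n
    set x : ℕ → ℝ := fun j => wt j * Real.sqrt (p j) with hx
    set y : ℕ → ℝ := fun j => 1 / Real.sqrt (p j) with hy
    have hxy : ∀ j, wt j = x j * y j := fun j => by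
      have : 0 < Real.sqrt (p j) := Real.sqrt_pos.2 (hp0 j)
      simp only [hx, hy]
      field_simp
    have hx2 : ∀ j, x j ^ 2 = G j := fun j => by
      simp only [hx, hwt, hGdef]
      by_cases hj : j ∈ A
      · rw [indicator_of_mem hj, indicator_of_mem hj, mul_pow, Real.sq_sqrt (hp0 j).le]
        simp only [hp]
        rw [q_iterate_greedy hq hg hj]
        push_cast
        ring
      · rw [indicator_of_notMem hj, indicator_of_notMem hj]
        ring
    have hy2 : ∀ j, y j ^ 2 = 1 / p j := fun j => by
      simp only [hy]
      rw [div_pow, one_pow, Real.sq_sqrt (hp0 j).le]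
    calc (∑ j ∈ range n, wt j) ^ 2 = (∑ j ∈ range n, x j * y j) ^ 2 := by
          rw [sum_congr rfl fun j _ => hxy j]
      _ ≤ (∑ j ∈ range n, x j ^ 2) * ∑ j ∈ range n, y j ^ 2 := sum_mul_sq_le_sq_mul_sq _ _ _
      _ = (∑ j ∈ range n, G j) * ∑ j ∈ range n, 1 / p j := by
          rw [sum_congr rfl fun j _ => hx2 j, sum_congr rfl fun j _ => hy2 j]
      _ ≤ (∑' j, G j) * (3 / Real.sqrt ((q v : ℝ) + 1)) := by
          refine mul_le_mul (hGsum.sum_le_tsum _ fun j _ => hG0 j) ?_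
            (sum_nonneg fun j _ => by simp only [one_div, inv_nonneg]; exact (hp0 j).le)
            (tsum_nonneg hG0)
          have := sum_range_one_div_mul_sqrt_le (q v) n
          refine le_trans (le_of_eq (sum_congr rfl fun j _ => ?_)) this
          simp only [hp]
          ring_nf
      _ = 3 / Real.sqrt ((q v : ℝ) + 1) * ∑' j, G j := by ring
  exact le_of_tendsto' (hS.pow 2) hCS

/-! ### Exchanging the order of summation -/

/-- **`Σ_{v ∈ S} τ(v)² ≤ 6 Σ_u (q u+1)² rad u²` for every finite set of vertices `S`**
(Jones–Smirnov 2000, p. 275: "a given cube `Q̃` is shadowed by exactly `q(Q̃)` cubes"): sum the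
Hölder bound over `v ∈ S`, exchange the sums, and note that a vertex `u = g^[j] v` on the greedy
chain of `v` determines `v = parent^[j] u` from its level `q v ≤ q u`; the levels contribute
`Σ_{l ≤ q u} 3 (l+1)^{-1/2} ≤ 6 (q u+1)^{1/2}`, and `(q u+1)^{3/2} (q u+1)^{1/2} = (q u+1)²`.
[cite: JonesSmirnov2000, §3 proof of Thm. 2 (p. 275)] -/
theorem sum_sq_le_of_isLUB (hq : ∀ v, v ≠ root → q v = q (parent v) + 1)
    (hrad : ∀ v, 0 ≤ rad v) (hsum : Summable fun v => ((q v : ℝ) + 1) ^ 2 * rad v ^ 2)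
    (hτ : ∀ v, IsLUB {s : ℝ | ∃ (m : ℕ) (c : ℕ → V), c 0 = v ∧ (∀ i < m, parent (c (i + 1)) = c i) ∧
      (∀ i < m, c (i + 1) ≠ root) ∧ s = ∑ i ∈ range (m + 1), rad (c i)} (τ v))
    (hg : ∀ v, (∃ w, parent w = v ∧ w ≠ root) →
      parent (g v) = v ∧ g v ≠ root ∧ ∀ w, parent w = v → w ≠ root → τ w ≤ τ (g v))
    (S : Finset V) :
    ∑ v ∈ S, τ v ^ 2 ≤ 6 * ∑' u, ((q u : ℝ) + 1) ^ 2 * rad u ^ 2 := by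
  classical
  set M : ℝ := ∑' u, ((q u : ℝ) + 1) ^ 2 * rad u ^ 2 with hM
  -- the active sets and the weights
  let A : V → Set ℕ := fun v => {j : ℕ | ∀ i < j, ∃ w, parent w = g^[i] v ∧ w ≠ root}
  let G : V → ℕ → ℝ := fun v => (A v).indicator fun j => rad (g^[j] v) ^ 2 *
    (((q (g^[j] v) : ℝ) + 1) * Real.sqrt ((q (g^[j] v) : ℝ) + 1))
  let cst : V → ℝ := fun v => 3 / Real.sqrt ((q v : ℝ) + 1)
  have hcst0 : ∀ v, 0 ≤ cst v := fun v => by positivity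
  have hG0 : ∀ v j, 0 ≤ G v j := fun v j => indicator_nonneg (fun _ _ => by positivity) _
  have hGsum : ∀ v, Summable (G v) := fun v => summable_weight hq hsum hg v
  -- Step 1: Hölder for each `v`
  have h1 : ∑ v ∈ S, τ v ^ 2 ≤ ∑ v ∈ S, ∑' j, cst v * G v j := by
    refine sum_le_sum fun v _ => ?_
    rw [tsum_mul_left]
    exact sq_le_of_isLUB hq hrad hsum hτ hg v
  -- Step 2: exchange `Σ_{v ∈ S}` and `Σ'_j`
  have h2 : ∑ v ∈ S, ∑' j, cst v * G v j = ∑' j, ∑ v ∈ S, cst v * G v j :=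
    (Summable.tsum_finsetSum fun v _ => (hGsum v).mul_left (cst v)).symm
  -- Step 3: the finite double sums are bounded by `6 M`
  have h3 : ∀ J, ∑ j ∈ range J, ∑ v ∈ S, cst v * G v j ≤ 6 * M := by
    intro J
    -- active pairs and the map to the vertex on the chain
    set P : Finset (V × ℕ) := (S ×ˢ range J).filter fun p => p.2 ∈ A p.1 with hP
    set e : V × ℕ → V := fun p => g^[p.2] p.1 with he
    have hlevel : ∀ p ∈ P, q (e p) = q p.1 + p.2 := fun p hp => by
      simp only [hP, mem_filter] at hp
      exact q_iterate_greedy hq hg hp.2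
    have hanc : ∀ p ∈ P, parent^[p.2] (e p) = p.1 := fun p hp => by
      simp only [hP, mem_filter] at hp
      exact iterate_parent_iterate_greedy hg hp.2
    -- rewrite the double sum as a sum over active pairs
    have hstep : ∑ j ∈ range J, ∑ v ∈ S, cst v * G v j =
        ∑ p ∈ P, cst p.1 * (rad (e p) ^ 2 * (((q (e p) : ℝ) + 1) * Real.sqrt ((q (e p) : ℝ) + 1))) := by
      rw [sum_comm, ← sum_product (s := S) (t := range J) (f := fun p => cst p.1 * G p.1 p.2), hP,
        sum_filter]
      refine sum_congr rfl fun p _ => ?_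
      by_cases hp : p.2 ∈ A p.1
      · rw [if_pos hp]
        simp only [G, indicator_of_mem hp, e]
      · rw [if_neg hp]
        simp only [G, indicator_of_notMem hp, mul_zero]
    rw [hstep, ← sum_fiberwise_of_maps_to (g := e) (t := P.image e) fun p hp => mem_image_of_mem e hp]
    -- bound each fibre
    have hfib : ∀ u ∈ P.image e,
        ∑ p ∈ P with e p = u, cst p.1 * (rad (e p) ^ 2 *
          (((q (e p) : ℝ) + 1) * Real.sqrt ((q (e p) : ℝ) + 1))) ≤
        6 * (((q u : ℝ) + 1) ^ 2 * rad u ^ 2) := by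
      intro u hu
      have hconst : ∀ p ∈ P.filter (fun p => e p = u), cst p.1 * (rad (e p) ^ 2 *
          (((q (e p) : ℝ) + 1) * Real.sqrt ((q (e p) : ℝ) + 1))) =
          (rad u ^ 2 * (((q u : ℝ) + 1) * Real.sqrt ((q u : ℝ) + 1))) * cst p.1 := fun p hp => by
        rw [(mem_filter.1 hp).2]
        ring
      rw [sum_congr rfl hconst, ← mul_sum]
      -- `Σ_{fibre} cst p.1 ≤ 3 · 2 √(q u + 1)` by injectivity of the level on the fibre
      have hinj : Set.InjOn (fun p : V × ℕ => q p.1) ↑(P.filter fun p => e p = u) := by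
        intro p hp p' hp' hpp
        simp only [coe_filter, mem_setOf_eq] at hp hp'
        have hl := hlevel p hp.1
        have hl' := hlevel p' hp'.1
        rw [hp.2] at hl
        rw [hp'.2] at hl'
        have hj : p.2 = p'.2 := by simp only at hpp; omega
        have hv : p.1 = p'.1 := by
          have h1 := hanc p hp.1
          have h2 := hanc p' hp'.1
          rw [hp.2] at h1
          rw [hp'.2, ← hj] at h2
          exact h1.symm.trans h2
        exact Prod.ext hv hj
      have hmaps : ∀ p ∈ P.filter (fun p => e p = u), q p.1 ∈ range (q u + 1) := fun p hp => by
        simp only [mem_filter] at hp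
        have hl := hlevel p hp.1
        rw [hp.2] at hl
        exact mem_range.2 (by omega)
      have hle : ∑ p ∈ P.filter (fun p => e p = u), cst p.1 ≤
          ∑ l ∈ range (q u + 1), 3 / Real.sqrt ((l : ℝ) + 1) := by
        calc ∑ p ∈ P.filter (fun p => e p = u), cst p.1
            = ∑ p ∈ P.filter (fun p => e p = u), (fun l : ℕ => 3 / Real.sqrt ((l : ℝ) + 1)) (q p.1) :=
              rfl
          _ = ∑ l ∈ (P.filter fun p => e p = u).image (fun p : V × ℕ => q p.1),
                3 / Real.sqrt ((l : ℝ) + 1) := by rw [sum_image hinj]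
          _ ≤ ∑ l ∈ range (q u + 1), 3 / Real.sqrt ((l : ℝ) + 1) :=
              sum_le_sum_of_subset_of_nonneg (image_subset_iff.2 hmaps) fun l _ _ => by positivity
      have hsq : ∑ l ∈ range (q u + 1), 3 / Real.sqrt ((l : ℝ) + 1) ≤ 6 * Real.sqrt ((q u : ℝ) + 1) := by
        have := sum_range_one_div_sqrt_le (q u)
        rw [show ∑ l ∈ range (q u + 1), 3 / Real.sqrt ((l : ℝ) + 1) =
          3 * ∑ l ∈ range (q u + 1), 1 / Real.sqrt ((l : ℝ) + 1) by rw [mul_sum]; simp [div_eq_mul_inv]]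
        linarith
      have hq1 : 0 ≤ (q u : ℝ) + 1 := by positivity
      calc rad u ^ 2 * (((q u : ℝ) + 1) * Real.sqrt ((q u : ℝ) + 1)) *
            ∑ p ∈ P.filter (fun p => e p = u), cst p.1
          ≤ rad u ^ 2 * (((q u : ℝ) + 1) * Real.sqrt ((q u : ℝ) + 1)) * (6 * Real.sqrt ((q u : ℝ) + 1)) := by
            exact mul_le_mul_of_nonneg_left (hle.trans hsq) (by positivity)
        _ = 6 * (((q u : ℝ) + 1) ^ 2 * rad u ^ 2) := by
            have : Real.sqrt ((q u : ℝ) + 1) * Real.sqrt ((q u : ℝ) + 1) = (q u : ℝ) + 1 :=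
              Real.mul_self_sqrt hq1
            linear_combination (rad u ^ 2 * ((q u : ℝ) + 1) * 6) * this
    calc ∑ u ∈ P.image e, ∑ p ∈ P with e p = u, cst p.1 * (rad (e p) ^ 2 *
            (((q (e p) : ℝ) + 1) * Real.sqrt ((q (e p) : ℝ) + 1)))
        ≤ ∑ u ∈ P.image e, 6 * (((q u : ℝ) + 1) ^ 2 * rad u ^ 2) := sum_le_sum hfib
      _ = 6 * ∑ u ∈ P.image e, ((q u : ℝ) + 1) ^ 2 * rad u ^ 2 := by rw [mul_sum]
      _ ≤ 6 * M := by
          gcongr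
          exact hsum.sum_le_tsum _ fun u _ => by positivity
  -- Step 4: conclude
  have h4 : ∑' j, ∑ v ∈ S, cst v * G v j ≤ 6 * M :=
    Real.tsum_le_of_sum_range_le (fun j => sum_nonneg fun v _ => mul_nonneg (hcst0 v) (hG0 v j)) h3
  linarith [h1, h2.le, h2.ge]

/-! ### The main result, self-contained -/

/-- **The shadow-size function** (Jones–Smirnov 2000, Thm. 2, pp. 274–275, planar case, on an
abstract rooted graph). Let `parent : V → V` have finite fibres off the root, levels
`q v = q (parent v) + 1` (`v ≠ root`), radii `rad ≥ 0` with `M = Σ_v (q v+1)² rad v² < ∞`. Then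
there is `τ : V → ℝ` with `0 ≤ rad ≤ τ`, dominating the tail sums of radii along every ray
(`Σ_n rad (x (k+n)) ≤ τ (x k)`, so every landing point of a ray through `v` is within `2κ τ v` of
`pos v`), and SQUARE-SUMMABLE: `Σ_v τ(v)² ≤ 6 M`. (`τ v` is the supremum of the radius sums of
the finite chains from `v`.) [cite: JonesSmirnov2000, §3 Thm. 2 (pp. 274–275)] -/
theorem exists_tailSup (hq : ∀ v, v ≠ root → q v = q (parent v) + 1) (hrad : ∀ v, 0 ≤ rad v)
    (hsum : Summable fun v => ((q v : ℝ) + 1) ^ 2 * rad v ^ 2)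
    (hfin : ∀ v, {w | parent w = v ∧ w ≠ root}.Finite) :
    ∃ τ : V → ℝ, (∀ v, 0 ≤ τ v) ∧ (∀ v, rad v ≤ τ v) ∧
      (∀ x : ℕ → V, (∀ n, parent (x (n + 1)) = x n) → (∀ n, x (n + 1) ≠ root) →
        ∀ k, ∑' n, rad (x (k + n)) ≤ τ (x k)) ∧
      (Summable fun v => τ v ^ 2) ∧
      ∑' v, τ v ^ 2 ≤ 6 * ∑' u, ((q u : ℝ) + 1) ^ 2 * rad u ^ 2 := by
  classical
  -- the chain sums and their supremum
  let C : V → Set ℝ := fun v => {s : ℝ | ∃ (m : ℕ) (c : ℕ → V), c 0 = v ∧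
    (∀ i < m, parent (c (i + 1)) = c i) ∧ (∀ i < m, c (i + 1) ≠ root) ∧
    s = ∑ i ∈ range (m + 1), rad (c i)}
  have hCne : ∀ v, (C v).Nonempty := fun v =>
    ⟨_, 0, fun _ => v, rfl, fun i hi => (Nat.not_lt_zero i hi).elim,
      fun i hi => (Nat.not_lt_zero i hi).elim, rfl⟩
  have hCbdd : ∀ v, BddAbove (C v) := fun v =>
    ⟨Real.sqrt (∑' u, ((q u : ℝ) + 1) ^ 2 * rad u ^ 2) * Real.sqrt (2 / ((q v : ℝ) + 1)), by
      rintro s ⟨m, c, hc0v, hc, hc0, rfl⟩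
      have := sum_rad_chain_le hq hc hc0 hrad hsum
      rwa [hc0v] at this⟩
  let τ : V → ℝ := fun v => sSup (C v)
  have hτ : ∀ v, IsLUB (C v) (τ v) := fun v => isLUB_csSup (hCne v) (hCbdd v)
  -- the greedy child
  have hgex : ∀ v, (∃ w, parent w = v ∧ w ≠ root) →
      ∃ w', (parent w' = v ∧ w' ≠ root) ∧ ∀ w, parent w = v → w ≠ root → τ w ≤ τ w' := by
    rintro v ⟨w, hw⟩
    obtain ⟨w', hw', hmax⟩ := (hfin v).toFinset.exists_max_image τ
      ⟨w, (hfin v).mem_toFinset.2 hw⟩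
    exact ⟨w', (hfin v).mem_toFinset.1 hw', fun u hu hu0 => hmax u ((hfin v).mem_toFinset.2 ⟨hu, hu0⟩)⟩
  choose! g hg using hgex
  have hg' : ∀ v, (∃ w, parent w = v ∧ w ≠ root) →
      parent (g v) = v ∧ g v ≠ root ∧ ∀ w, parent w = v → w ≠ root → τ w ≤ τ (g v) :=
    fun v hv => ⟨(hg v hv).1.1, (hg v hv).1.2, (hg v hv).2⟩
  refine ⟨τ, nonneg_of_isLUB hrad hτ, rad_le_of_isLUB hτ, ?_, ?_, ?_⟩
  · -- tails of rays are chain sums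
    intro x hx hx0 k
    refine Real.tsum_le_of_sum_range_le (fun _ => hrad _) fun N => ?_
    cases N with
    | zero => simpa using nonneg_of_isLUB hrad hτ (x k)
    | succ N =>
      exact (hτ (x k)).1 ⟨N, fun n => x (k + n), by simp, fun i _ => hx (k + i),
        fun i _ => hx0 (k + i), rfl⟩
  · exact summable_of_sum_le (fun v => sq_nonneg (τ v)) fun S => sum_sq_le_of_isLUB hq hrad hsum hτ hg' S
  · exact Real.tsum_le_of_sum_le (fun v => sq_nonneg (τ v)) fun S => sum_sq_le_of_isLUB hq hrad hsum hτ hg' S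

end Greedy

end Literature.Probability.RandomPlanarGeometry
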